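import Literature.Topology.FourManifolds.RegularSlabCobordism
import Literature.Topology.FourManifolds.WallHandlebodyHomology
import Literature.Topology.FourManifolds.WallHandlebodyLevels
import Literature.Topology.FourManifolds.HCobordismWallDuality
import Literature.Topology.FourManifolds.HCobordantOfDiffeomorph
import Literature.Topology.FourManifolds.CobordismEndLevelsDiffeo
import Literature.AlgebraicTopology.Homotopy.WhiteheadTheoremProofs
import Literature.AlgebraicTopology.Homotopy.CompactManifoldCWTypeProofs
import HarnessLib

/-!
# Wall 1964, Lemma 2, Morse-theoretic route: the top part `C` is an h-cobordism

Topic `Literature/Topology/FourManifolds` (fact seat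
`provefact-Literature.Topology.FourManifolds.exists-68ee520c9a`, Wall 1964, Lemma 2,
`WallBoundingHandlebody.lean`; item 5 of the route recorded there).  Everything here is
**proved**, GIVEN the duality step `Hᵢ(C, L) ≅ H⁵⁻ⁱ(C, M)` in the form of the tree's named fact
`Cobordism.isZero_relativeSingularHomology_inl_of_inr_le` (`HCobordismWallDuality.lean`, a
hypothesis throughout); no named facts are introduced.

Setting (the output of `WallHandlebodyProgram.lean` and `WallHandlebodyLevels.lean`): a Morse
function `g` on a 5-dimensional cobordism `d = (K; V, P)` with `V`, `P` simply connected, all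
critical points of index `≥ 2`, a non-critical level `m ∈ (0, 1)` below which all critical
points have index `2`, and `H⁎({g ≤ 1}, {g ≤ m}; ℤ) = 0`.  Then
(`Cobordism.IsMorseFunction.exists_isHCobordism_upperSlab`) for a suitable non-critical `b₁`
between the critical values and `1`, the slab `C = g⁻¹[m, b₁]` with its two ends
`L = g⁻¹(m)`, `g⁻¹(b₁) ≅ P` (`RegularSlab.cobordism`, Milnor's Lemma 2.9 / the tree's
`RegularSlabCobordism.lean`) is an **h-cobordism**, and `P ≃ₘ` its outgoing end:

* `Hᵢ(C, L) = 0` for all `i`: `Hᵢ(C, L) ≅ Hᵢ({g ≤ b₁}, {g ≤ m}) ≅ Hᵢ({g ≤ 1}, {g ≤ m}) = 0`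
  (Milnor PDF p. 46 and the collar above `b₁`, `WallHandlebodyHomology.lean`) — Wall:
  "by construction, the inclusion of `H` in `W` is a homology equivalence. Hence, by excision,
  `Hᵢ(C, ∂H) = Hᵢ(W, H) = 0`";
* `Hᵢ(C, g⁻¹(b₁)) = 0` for all `i`: the duality step applied to the reversed cobordism, `C`
  being simply connected (`WallHandlebodyLevels.lean`) — Wall: "`H₅₋ᵢ(C, M)` vanishes too";
* `L`, `C` simply connected (`WallHandlebodyLevels.lean`), `g⁻¹(b₁) ≅ P` simply connected, so
  the recognition theorem (`Cobordism.isHCobordism_of_isZero_relativeSingularHomology`,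
  Whitehead + CW type of compact manifolds, all discharged in the tree) makes `C` an
  h-cobordism — Wall: "from which it follows that `C` is an h-cobordism. Hence `M` is
  h-cobordant to `∂H`, as stated."

## References

* C. T. C. Wall, *On simply-connected 4-manifolds*, J. London Math. Soc. 39 (1964), Lemma 2
  and its proof (pp. 143–144). [WallJLMS1964]
* J. Milnor, *Lectures on the h-cobordism theorem* (1965), Lemma 2.9, Thm. 3.4 / Cor. 3.5,
  PDF p. 46. [MilnorHCobordism1965]
* A. Hatcher, *Algebraic Topology* (2002), Thm. 3.43, Cor. 4.33, Cor. A.12. [HatcherAT2002]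
-/

open scoped Manifold ContDiff Topology
open Set Function CategoryTheory CategoryTheory.Limits
open Literature.AlgebraicTopology.SingularHomology Literature.AlgebraicTopology.Homotopy

noncomputable section

universe u

namespace Literature.Topology.FourManifolds

/-- Local notation: `𝔼 n` is the model Euclidean space `EuclideanSpace ℝ (Fin n)`. -/
local notation "𝔼 " n:arg => EuclideanSpace ℝ (Fin n)

variable {V P : Type u} [TopologicalSpace V] [T2Space V] [SecondCountableTopology V]
  [ChartedSpace (𝔼 4) V] [IsManifold (𝓡 4) ∞ V] [CompactSpace V]
  [TopologicalSpace P] [T2Space P] [SecondCountableTopology P] [ChartedSpace (𝔼 4) P]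
  [IsManifold (𝓡 4) ∞ P] [CompactSpace P]

omit [T2Space V] [SecondCountableTopology V] [IsManifold (𝓡 4) ∞ V] [CompactSpace V] [T2Space P]
  [SecondCountableTopology P] [CompactSpace P] in
/-- **A collar level below the outgoing end**: for a Morse function `g` on a cobordism
`(K; V, P)` and any `m < 1` there is a non-critical `b₁ ∈ (m, 1)` above every critical value
such that every smooth manifold smoothly embedded onto `g⁻¹(b₁)` is a copy of `P` (Milnor 1965,
Thm. 3.4 / Cor. 3.5 on the reversed triad; the tree's
`Cobordism.IsMorseFunction.exists_pos_nonempty_diffeomorph_level`). [cite: MilnorHCobordism1965, Thm. 3.4 and Cor. 3.5 (PDF pp. 12–13)] -/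
theorem Cobordism.IsMorseFunction.exists_collarLevel_top {d : Cobordism 4 V P} {g : d.W → ℝ}
    (hg : d.IsMorseFunction g) {m : ℝ} (hm1 : m < 1) :
    ∃ b₁ : ℝ, m < b₁ ∧ b₁ < 1 ∧ (∀ z ∈ criticalSet (𝓡∂ (4 + 1)) g, g z < b₁) ∧
      ∀ (V' : Type u) [TopologicalSpace V'] [ChartedSpace (𝔼 4) V'] [IsManifold (𝓡 4) ∞ V']
        (ι : V' → d.W), Manifold.IsSmoothEmbedding (𝓡 4) (𝓡∂ (4 + 1)) ∞ ι →
          range ι = g ⁻¹' {b₁} → Nonempty (P ≃ₘ⟮𝓡 4, 𝓡 4⟯ V') := by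
  classical
  obtain ⟨ε₀, hε₀, H⟩ := hg.symm.exists_pos_nonempty_diffeomorph_level
  -- the largest critical value (or `m` if there is none)
  have hfin : (criticalSet (𝓡∂ (4 + 1)) g).Finite := hg.finite_criticalSet
  obtain ⟨c₀, hc₀1, hc₀⟩ : ∃ c₀ : ℝ, c₀ < 1 ∧ ∀ z ∈ criticalSet (𝓡∂ (4 + 1)) g, g z ≤ c₀ := by
    by_cases hne : (criticalSet (𝓡∂ (4 + 1)) g).Nonempty
    · obtain ⟨qm, hqm, hqmax⟩ := Set.exists_max_image _ g hfin hne
      exact ⟨g qm, (hg.apply_mem_Ioo_of_mem_criticalSet hqm).2, hqmax⟩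
    · exact ⟨0, one_pos, fun z hz => absurd ⟨z, hz⟩ hne⟩
  set ε' : ℝ := min ε₀ ((1 - max m c₀) / 2) with hε'
  have hmax1 : max m c₀ < 1 := max_lt hm1 hc₀1
  have hε'pos : 0 < ε' := lt_min hε₀ (by linarith)
  have hε'le : ε' ≤ ε₀ := min_le_left _ _
  have hε'lt : ε' < 1 - max m c₀ := (min_le_right _ _).trans_lt (by linarith)
  refine ⟨1 - ε', by have := le_max_left m c₀; linarith, by linarith, fun z hz => ?_,
    fun V' _ _ _ ι hι hrange => ?_⟩
  · have h1 := hc₀ z hz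
    have h2 := le_max_right m c₀
    linarith
  · refine H ε' hε'pos hε'le V' ι hι ?_
    have key : (g ⁻¹' {1 - ε'} : Set d.W) = (fun z : d.W => 1 - g z) ⁻¹' {ε'} := by
      ext z
      simp only [mem_preimage, mem_singleton_iff]
      constructor <;> intro h <;> linarith
    exact hrange.trans key

/-- **The relative homology of a slab whose top sublevel pair is acyclic**: if
`H⁎({g ≤ 1}, {g ≤ m}) = 0` and `b₁ ∈ (m, 1)` is non-critical with every critical value `< b₁`,
then `H⁎(g⁻¹[m, b₁], g⁻¹(m); ℤ) = 0` (Milnor PDF p. 46 and the collar without critical points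
above `b₁`). [cite: MilnorHCobordism1965, PDF p. 46 and Cor. 3.15] [cite: WallJLMS1964, proof of Lemma 2 (p. 144: "Hᵢ(C, ∂H) = Hᵢ(W, H) = 0")] -/
theorem Cobordism.IsMorseFunction.isZero_relativeSingularHomology_upperSlab {d : Cobordism 4 V P}
    {g : d.W → ℝ} (hg : d.IsMorseFunction g) {m b₁ : ℝ} (hm0 : 0 < m) (hmb : m < b₁) (hb1 : b₁ < 1)
    (hregm : ∀ z ∈ criticalSet (𝓡∂ (4 + 1)) g, g z ≠ m)
    (hcrit : ∀ z ∈ criticalSet (𝓡∂ (4 + 1)) g, g z < b₁)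
    (hacyc : ∀ i, IsZero (sublevelHomology g m 1 i)) (i : ℕ) :
    IsZero (relativeSingularHomology ℤ ℤ ↥(g ⁻¹' Icc m b₁) {z | g z.1 = m} i) := by
  haveI := Cobordism.Milnor1965_slabHomology_iso_holds hg hm0 hmb
    (fun z hz => ⟨hregm z hz, (hcrit z hz).ne⟩) i
  haveI := isIso_sublevelMap_one hg hmb.le (hm0.le.trans hmb.le) hb1 hcrit i
  exact ((hacyc i).of_iso (asIso (sublevelMap g m hb1.le i))).of_iso
    (asIso (relativeSingularHomology.map ℤ ℤ (slabToSublevel g m b₁) (mapsTo_slabToSublevel g m b₁) i))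

/-- **Wall 1964, proof of Lemma 2: the top part `C = g⁻¹[m, b₁]` is an h-cobordism, and its
outgoing end is a copy of `P`** (the module docstring displays the argument): GIVEN the duality
step `Cobordism.isZero_relativeSingularHomology_inl_of_inr_le`, for a Morse function `g` on a
5-dimensional cobordism `(K; V, P)` with `V`, `P` simply connected, all indices `≥ 2`, a
non-critical `m ∈ (0, 1)` below which all critical points have index `2`, and
`H⁎({g ≤ 1}, {g ≤ m}; ℤ) = 0`, there is a non-critical `b₁ ∈ (m, 1)` above the critical values
such that the slab cobordism `(g⁻¹[m, b₁]; g⁻¹(m), g⁻¹(b₁))` is an h-cobordism and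
`P ≃ₘ g⁻¹(b₁)`. [cite: WallJLMS1964, Lemma 2 and its proof (pp. 143–144)] [cite: MilnorHCobordism1965, Lemma 2.9, Cor. 3.5, PDF p. 46] [cite: HatcherAT2002, Thm. 3.43, Cor. 4.33, Cor. A.12] -/
theorem Cobordism.IsMorseFunction.exists_isHCobordism_upperSlab
    (hD : Cobordism.isZero_relativeSingularHomology_inl_of_inr_le.{u})
    {d : Cobordism 4 V P} {g : d.W → ℝ} (hg : d.IsMorseFunction g)
    [SimplyConnectedSpace V] [SimplyConnectedSpace P]
    (h2 : ∀ z ∈ criticalSet (𝓡∂ (4 + 1)) g, 2 ≤ morseIndex (𝓡∂ (4 + 1)) g z)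
    {m : ℝ} (hm : m ∈ Ioo (0 : ℝ) 1) (hregm : ∀ z ∈ criticalSet (𝓡∂ (4 + 1)) g, g z ≠ m)
    (hidx : ∀ z ∈ criticalSet (𝓡∂ (4 + 1)) g, g z < m → morseIndex (𝓡∂ (4 + 1)) g z = 2)
    (hacyc : ∀ i, IsZero (sublevelHomology g m 1 i)) :
    ∃ (b₁ : ℝ) (h₁ : d.IsRegularSlab g m b₁),
      (RegularSlab.cobordism h₁).IsHCobordism ∧ Nonempty (P ≃ₘ⟮𝓡 4, 𝓡 4⟯ RegularSlab.topEnd h₁) := by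
  obtain ⟨b₁, hmb, hb1, hcrit, hP⟩ := hg.exists_collarLevel_top hm.2
  have h₁ : d.IsRegularSlab g m b₁ :=
    { isMorseFunction := hg
      pos := hm.1
      lt := hmb
      lt_one := hb1
      ne_left := fun z hz => hregm z hz
      ne_right := fun z hz => (hcrit z hz).ne }
  refine ⟨b₁, h₁, ?_, ?_⟩
  swap
  · exact hP _ (fun p : RegularSlab.topEnd h₁ => RegularSlab.incl h₁ p.1)
      (RegularSlab.isSmoothEmbedding_incl_topEnd h₁) (RegularSlab.range_incl_topEnd h₁)
  set d₁ := RegularSlab.cobordism h₁ with hd₁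
  -- `C = g⁻¹[m, b₁]` is simply connected
  have hC : IsSimplyConnected (g ⁻¹' Icc m b₁) :=
    hg.isSimplyConnected_slab_of_index_two_below hm hmb hb1
      (fun z hz => ⟨hregm z hz, (hcrit z hz).ne⟩) h2 hidx
  haveI hCW : SimplyConnectedSpace d₁.W := hC.simplyConnectedSpace
  -- the incoming end `L = g⁻¹(m)` is simply connected
  have hL : IsSimplyConnected (g ⁻¹' {m}) := hg.isSimplyConnected_level_of_index_two_below hm hregm hidx
  haveI : SimplyConnectedSpace (RegularSlab.botEnd h₁) := by
    have h := (RegularSlab.isEmbedding_incl_botEnd h₁).isSimplyConnected_image (s := univ)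
    rw [image_univ, RegularSlab.range_incl_botEnd] at h
    exact (Homeomorph.Set.univ (RegularSlab.botEnd h₁)).toHomotopyEquiv.simplyConnectedSpace_iff.1
      (h.1 hL).simplyConnectedSpace
  -- the outgoing end is a copy of `P`, hence simply connected
  haveI : SimplyConnectedSpace (RegularSlab.topEnd h₁) := by
    obtain ⟨e⟩ := hP _ (fun p : RegularSlab.topEnd h₁ => RegularSlab.incl h₁ p.1)
      (RegularSlab.isSmoothEmbedding_incl_topEnd h₁) (RegularSlab.range_incl_topEnd h₁)
    exact e.toHomeomorph.toHomotopyEquiv.simplyConnectedSpace_iff.1 inferInstance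
  -- `H⁎(C, L) = 0`
  have hM : ∀ k, IsZero (relativeSingularHomology ℤ ℤ d₁.W (range d₁.inl) k) := by
    intro k
    rw [hd₁, RegularSlab.range_cobordism_inl]
    exact hg.isZero_relativeSingularHomology_upperSlab hm.1 hmb hb1 hregm hcrit hacyc k
  -- `H⁎(C, g⁻¹(b₁)) = 0` by duality on the reversed cobordism
  have hN : ∀ k, IsZero (relativeSingularHomology ℤ ℤ d₁.W (range d₁.inr) k) := by
    obtain ⟨z, hz⟩ := d₁.exists_isRelFundamentalClass_of_simplyConnectedSpace
    intro k
    exact hD 4 5 _ _ d₁.symm z hz (fun j _ => hM j) k (by omega)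
  exact d₁.isHCobordism_of_isZero_relativeSingularHomology whitehead_exists_homotopyEquiv_holds
    exists_cwComplex_homotopyEquiv_of_compactSpace_holds
    exists_cwComplex_homotopyEquiv_of_compactSpace_boundary_holds hM hN

/-- **Corollary: `g⁻¹(m)` and `P` are h-cobordant** (with the ends read as the incoming end of
the slab cobordism and `P`). [cite: WallJLMS1964, Lemma 2 (pp. 143–144: "M is h-cobordant to ∂H")] -/
theorem Cobordism.IsMorseFunction.exists_isHCobordant_botEnd
    (hD : Cobordism.isZero_relativeSingularHomology_inl_of_inr_le.{u})
    {d : Cobordism 4 V P} {g : d.W → ℝ} (hg : d.IsMorseFunction g)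
    [SimplyConnectedSpace V] [SimplyConnectedSpace P]
    (h2 : ∀ z ∈ criticalSet (𝓡∂ (4 + 1)) g, 2 ≤ morseIndex (𝓡∂ (4 + 1)) g z)
    {m : ℝ} (hm : m ∈ Ioo (0 : ℝ) 1) (hregm : ∀ z ∈ criticalSet (𝓡∂ (4 + 1)) g, g z ≠ m)
    (hidx : ∀ z ∈ criticalSet (𝓡∂ (4 + 1)) g, g z < m → morseIndex (𝓡∂ (4 + 1)) g z = 2)
    (hacyc : ∀ i, IsZero (sublevelHomology g m 1 i)) :
    ∃ (b₁ : ℝ) (h₁ : d.IsRegularSlab g m b₁), IsHCobordant 4 P (RegularSlab.botEnd h₁) := by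
  obtain ⟨b₁, h₁, hH, ⟨e⟩⟩ := hg.exists_isHCobordism_upperSlab hD h2 hm hregm hidx hacyc
  have hc : IsHCobordant 4 (RegularSlab.botEnd h₁) (RegularSlab.topEnd h₁) := ⟨_, hH⟩
  exact ⟨b₁, h₁, (hc.of_diffeomorph_right e).symm⟩

end Literature.Topology.FourManifolds
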